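import Literature.MathematicalPhysics.QuantumFieldTheory.Balaban1983to89.B16Sect1Assembly

/-!
# `Balaban1983to89.B16Eq12ChartExpansion` — T. Bałaban, *Large field renormalization. II. Localization, exponentiation,
and bounds for the 𝐑 operation*, Commun. Math. Phys. **122** (1989) 355–392 [Balaban1989LargeFieldII], pp. 356–357:
the identity **(1.2)** DERIVED, as print derives it, from its two named inputs — the chart change of variables
*"Writing V′ = exp ig_kB′"* and the expansion of the action *"using (2.8) [I]"* ([I] = T. Bałaban, *Renormalization group
approach to lattice gauge field theories. I*, Commun. Math. Phys. **109** (1987) 249–301 [Balaban1987RG1], (2.8) p. 266)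

statement-level skeleton of published theorems with citation tags; proofs where landed; nothing here is a claim about
the Yang–Mills mass gap

PDF held: `paper:balaban1989-cmp122-large-field-ii` (journal page = PDF page + 354), pp. 356–357 [PDF 2–3];
`paper:balaban1987-cmp109-rg-i-small-field`, pp. 265–267 [PDF 17–19] (text layer re-read this session:
`lit read … --pages 17-19`).

CITATION HEADER / WHAT IS REPRODUCED (mega-formalization `lit-balaban`, B16 owner r13 gen 103; rows
`lit-balaban-r13/ROWS-B16.md`): SKELETON row **B16.Eq1.2** (owner audit `READING-RULE-AUDIT-B16-g100.md` §4: *"an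
IDENTITY row — print DERIVES it … (b) ✗ (the change of variables (2.8) [I] on the carrier is not a kernel theorem here).
Owed: (2.8) [I] instance for the Λ-integral"*).  [LF-II] pp. 356–357, verbatim: *"Writing V′ = exp ig_kB′, identifying Λ
with one of its components, and using (2.8) [I], we get
  ∫dV′↾_Λ δ_{G₀}(V′)χ exp[−(1/g_k²)A(ζ₀, U_{k,Z}(V′V_Λ))] = exp[−(1/g_k²)A(ζ₀, U₀) + (−½d(g) log g_k⁻² + log σ₀)|Λ^{(k)}∖G₀|]
  · ∫dB′↾_Λ σ(g_kB′)δ_{G₀}(B′)χ({|B′| < M₀g_k⁻¹ε_k}) exp[−½⟨H_{1,k}B′, Δ₁(ζ₀)H_{1,k}B′⟩ − (1/g_k)⟨DH_{1,k}B′, ζ₀η⁻² Im ∂U₀⟩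
  − (1/g_k²)V(ζ₀, g_kH_{1,k}B′)]. (1.2)"*; [I] p. 266, verbatim: *"Denoting terms of at least third order in H₁B′ by V(H₁B′)
we get A(U_k(B′)) = A(U_{k+1}) + ⟨H₁B′, J⟩ + ½⟨H₁B′, Δ₁H₁B′⟩ + V(H₁B′). (2.8)"*; [I] p. 267: *"(2.1) = log N_k⁻¹ ∫dB′σ(B′)
δ(Q̃(B′))χ_k exp[…] (2.10) where the factors σ₀ are included into the normalization factor N_k"*.

The tree (`B16Sect1Assembly`, r13 gen 4) types (1.2) as the `Prop` `Eq12` over EXPLICIT measure spaces: `den11` = the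
left side against `μV = dV′↾_Λ δ_{G₀}(V′)χ`, `int12` = the `B′`-integral against `μB = dB′↾_Λ δ_{G₀}(B′)` with the weight
`wB = σ(g_kB′)χ(…)` and the exponent functions `Q`, `L`, `V`; `Ek110` = the constant `(−½d(g) log g_k⁻² + log σ₀)|Λ^{(k)}∖G₀|`.
THIS FILE proves `Eq12` from print's two inputs, each a hypothesis predicate WITH BODY on the same carriers:
* `ChartCOV` — *"Writing V′ = exp ig_kB′"*: the integral against `μV` of any function of `V′↾_Λ` equals `exp E_k(Λ)` times
  the integral against `μB` of the function composed with the chart `B′ ↦ exp ig_kB′·(…)`, weighted by `σ(g_kB′)χ(…)` (the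
  Haar measure in the exponential chart, `dV′ = σ(B′)dB′` bondwise [I] (2.10), rescaled `B′ ↦ g_kB′`: the factor
  `g_k^{d(g)}σ₀` per bond of `Λ^{(k)}∖G₀` is `exp E_k(Λ)`; the characteristic function `χ` becomes `χ({|B′| < M₀g_k⁻¹ε_k})`);
  NON-VACUOUS: it holds whenever `μV` is the image under a measurable equivalence of `exp E_k(Λ) · wB·μB`
  (`chartCOV_map_withDensity`, Mathlib `integral_map_equiv` + `integral_withDensity_eq_integral_smul`);
* `Expansion28` — *"using (2.8) [I]"* in LF-II's `g_k`-scaled variables (`B′ ↦ g_kB′`, `A ↦ A(ζ₀, ·)`): along the chart,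
  `A(ζ₀, U_{k,Z}(V′V_Λ)) = A(ζ₀, U₀) + g_k L(B′) + ½g_k² Q(B′) + V(B′)` with `L`, `Q`, `V` the three exponent functions of
  (1.2) (the linear term `⟨DH_{1,k}B′, ζ₀η⁻²Im ∂U₀⟩` is (2.8)'s `⟨H₁B′, J⟩` for the current of `U₀`; row B12.Eq2.6-2.8, r09's
  `B12ActionExpansion26.eq28`);
and then **`eq12_of_chartCOV_of_expansion28`**: (1.2) — `exp` of the expanded exponent splits, the constant
`exp(−g_k⁻²A(ζ₀,U₀))` leaves the integral (`integral_const_mul`, no integrability needed), the two constants combine.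
NOT asserted: the inputs themselves (rows B12.Eq2.10 ∕ B12.Eq2.6-2.8 house them); the criticality (1.4)–(1.5) of `U₀`
(which print uses only AFTER (1.2), for (1.3)–(1.5)).  No `sorry`, no axiom, no `Prop`-valued fact.
-/

open MeasureTheory

namespace Literature.MathematicalPhysics.QuantumFieldTheory.Balaban1983to89.B16Eq12ChartExpansion

open B16Sect1Assembly B16Sect1Wilson

noncomputable section

variable {ΩV ΩB : Type*} [MeasurableSpace ΩV] [MeasurableSpace ΩB]

/-! ## §1. The two printed inputs of (1.2) as hypothesis predicates with bodies -/

/-- **"Writing V′ = exp ig_kB′"** (p. 356) — the chart change of variables for the gauge-fixed Haar integral over the bond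
variables of `Λ`: for every function `f` of `V′↾_Λ`, `∫ f dμV = exp E_k(Λ) · ∫ σ(g_kB′)χ(…)·f(chart B′) dμB` with
`μV = dV′↾_Λ δ_{G₀}(V′)χ`, `μB = dB′↾_Λ δ_{G₀}(B′)`, `wB = σ(g_kB′)χ({|B′| < M₀g_k⁻¹ε_k})`, `chart B′ = ` the point `V′ = exp ig_kB′`
of `ΩV`, and `E_k(Λ) = (−½d(g) log g_k⁻² + log σ₀)|Λ^{(k)}∖G₀|` (`Ek110`; [I] (2.10): `dV′ = σ(B′)dB′`, *"the factors σ₀ are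
included into the normalization factor"*). [cite: Balaban1989LargeFieldII, (1.2) p.356; Balaban1987RG1, (2.10) p.267] -/
def ChartCOV (gk dg σ₀ : ℝ) (n : ℕ) (μV : Measure ΩV) (μB : Measure ΩB) (wB : ΩB → ℝ) (chart : ΩB → ΩV) : Prop :=
  ∀ f : ΩV → ℝ, ∫ v, f v ∂μV = Real.exp (Ek110 dg gk σ₀ n) * ∫ b, wB b * f (chart b) ∂μB

/-- **"using (2.8) [I]"** — [I] p. 266 (2.8) *"A(U_k(B′)) = A(U_{k+1}) + ⟨H₁B′, J⟩ + ½⟨H₁B′, Δ₁H₁B′⟩ + V(H₁B′)"* in LF-II's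
`g_k`-scaled variables along the chart: `AV(chart B′) = A(ζ₀,U₀) + g_k·L(B′) + ½g_k²·Q(B′) + V(B′)`, where `AV = A(ζ₀,
U_{k,Z}(V′V_Λ))`, `A00 = A(ζ₀, U₀)`, `L B′ = ⟨DH_{1,k}B′, ζ₀η⁻² Im ∂U₀⟩`, `Q B′ = ⟨H_{1,k}B′, Δ₁(ζ₀)H_{1,k}B′⟩`, `V B′ = V(ζ₀,
g_kH_{1,k}B′)` (the letters of `B16Sect1Assembly.int12`). [cite: Balaban1987RG1, (2.8) p.266; Balaban1989LargeFieldII, (1.2) p.357] -/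
def Expansion28 (gk A00 : ℝ) (AV : ΩV → ℝ) (chart : ΩB → ΩV) (Q L V : ΩB → ℝ) : Prop :=
  ∀ b, AV (chart b) = A00 + gk * L b + gk ^ 2 / 2 * Q b + V b

/-! ## §2. (1.2) derived -/

/-- The exponent algebra of (1.2): `−g_k⁻²(A₀₀ + g_kL + ½g_k²Q + V) = −g_k⁻²A₀₀ + (−½Q − g_k⁻¹L − g_k⁻²V)` (`g_k ≠ 0`).
[cite: Balaban1989LargeFieldII, (1.2) p.357] -/
theorem exponent_split {gk : ℝ} (hgk : gk ≠ 0) (A00 l q v : ℝ) :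
    -(1 / gk ^ 2) * (A00 + gk * l + gk ^ 2 / 2 * q + v)
      = -(1 / gk ^ 2) * A00 + (-(1 / 2) * q - 1 / gk * l - 1 / gk ^ 2 * v) := by
  field_simp
  ring

/-- **(1.2) PROVED from its two printed inputs**: the chart change of variables (`ChartCOV`, *"Writing V′ = exp ig_kB′"*)
and the expansion of the action along the chart (`Expansion28`, *"using (2.8) [I]"*) give the tree's `Eq12` —
`∫dV′↾_Λ δ_{G₀}χ e^{−g_k⁻²A(ζ₀,U_{k,Z}(V′V_Λ))} = exp[−g_k⁻²A(ζ₀,U₀) + E_k(Λ)] · ∫dB′↾_Λ σ(g_kB′)δ_{G₀}χ(…) e^{−½Q − g_k⁻¹L − g_k⁻²V}`.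
[cite: Balaban1989LargeFieldII, (1.2) p.357] -/
theorem eq12_of_chartCOV_of_expansion28 {gk A00 dg σ₀ : ℝ} {n : ℕ} {μV : Measure ΩV} {AV : ΩV → ℝ}
    {μB : Measure ΩB} {wB Q L V : ΩB → ℝ} {chart : ΩB → ΩV} (hgk : gk ≠ 0)
    (hcov : ChartCOV gk dg σ₀ n μV μB wB chart) (h28 : Expansion28 gk A00 AV chart Q L V) :
    Eq12 gk A00 dg σ₀ n μV AV μB wB Q L V := by
  unfold Eq12 den11 int12
  rw [hcov]
  have hpt : ∀ b, wB b * Real.exp (-(1 / gk ^ 2) * AV (chart b))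
      = Real.exp (-(1 / gk ^ 2) * A00)
          * (wB b * Real.exp (-(1 / 2) * Q b - 1 / gk * L b - 1 / gk ^ 2 * V b)) := by
    intro b
    rw [h28 b, exponent_split hgk, Real.exp_add]
    ring
  simp_rw [hpt]
  rw [integral_const_mul, ← mul_assoc, ← Real.exp_add, add_comm]

/-- With (1.2) derived, the tree's (1.2) ↔ (1.10) link applies: the `B′`-integral is `exp(−I(U₀))` for the number `I(U₀)`
defined by (1.10) (`B16Sect1Assembly.eq12_exp_neg_I110`). [cite: Balaban1989LargeFieldII, (1.10) p.358] -/
theorem int12_eq_exp_neg_I110 {gk A00 dg σ₀ : ℝ} {n : ℕ} {μV : Measure ΩV} {AV : ΩV → ℝ}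
    {μB : Measure ΩB} {wB Q L V : ΩB → ℝ} {chart : ΩB → ΩV} (hgk : gk ≠ 0)
    (hcov : ChartCOV gk dg σ₀ n μV μB wB chart) (h28 : Expansion28 gk A00 AV chart Q L V)
    (hpos : 0 < den11 gk μV AV) :
    int12 gk μB wB Q L V = Real.exp (-I110 gk A00 (Ek110 dg gk σ₀ n) (den11 gk μV AV)) :=
  eq12_exp_neg_I110 (eq12_of_chartCOV_of_expansion28 hgk hcov h28) hpos

/-! ## §3. Non-vacuity of the change-of-variables hypothesis -/

/-- **`ChartCOV` is what a chart with a density IS**: if `μV` is the image, under a measurable equivalence `e : ΩB ≃ᵐ ΩV`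
(the chart), of the measure `exp E_k(Λ) · wB·μB` (`wB ≥ 0` measurable — the Jacobian `σ(g_kB′)` times the characteristic
function), then `ChartCOV` holds for EVERY `f` (Mathlib `integral_map_equiv`, `integral_withDensity_eq_integral_smul`).
[cite: Balaban1989LargeFieldII, (1.2) p.356; Balaban1987RG1, (2.10) p.267] -/
theorem chartCOV_map_withDensity (gk dg σ₀ : ℝ) (n : ℕ) (μB : Measure ΩB) {w : ΩB → NNReal} (hw : Measurable w)
    (e : ΩB ≃ᵐ ΩV) :
    ChartCOV gk dg σ₀ n
      (Measure.map e ((ENNReal.ofReal (Real.exp (Ek110 dg gk σ₀ n))) • μB.withDensity (fun b => (w b : ENNReal))))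
      μB (fun b => (w b : ℝ)) e := by
  intro f
  rw [integral_map_equiv, integral_smul_measure, integral_withDensity_eq_integral_smul hw,
    ENNReal.toReal_ofReal (Real.exp_pos _).le]
  simp only [NNReal.smul_def, smul_eq_mul]

/-- The expansion hypothesis is consistent too: it holds by definition when `AV` is read off along the chart (e.g. the
chart a measurable equivalence and `AV := (A00 + g_kL + ½g_k²Q + V) ∘ e⁻¹`). [cite: Balaban1987RG1, (2.8) p.266] -/
theorem expansion28_comp_symm (gk A00 : ℝ) (Q L V : ΩB → ℝ) (e : ΩB ≃ᵐ ΩV) :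
    Expansion28 gk A00 (fun v => A00 + gk * L (e.symm v) + gk ^ 2 / 2 * Q (e.symm v) + V (e.symm v)) e Q L V := by
  intro b
  simp

end

end Literature.MathematicalPhysics.QuantumFieldTheory.Balaban1983to89.B16Eq12ChartExpansion
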